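import Literature.AlgebraicGeometry.Motives.ZarhinHodgeGroupLieAlgebra
import Literature.AlgebraicGeometry.Motives.MumfordTateInvariantsOrthonormalBasis
import Mathlib.Analysis.InnerProductSpace.Projection.Basic
import HarnessLib

/-!
# Positivity: the complexified Lie algebra of the Hodge group is closed under the Hodge-form adjoint, and its stable subspaces of an `End_Hdg`-eigenspace are trivial (Zarhin's theorem, step 5)

For a polarized pure `ℚ`-Hodge structure `(H, ψ)` of weight `n` on a finite-dimensional `V` we
use the positive definite hermitian **Hodge form** `h(x, y) = ψ_ℂ(C x, conj y)` on `V_ℂ`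
(`C` the Weil operator, `i^{p-q}` on `V^{p,q}`; second Hodge–Riemann relation), through an
`h`-orthonormal graded basis of `V_ℂ` (`Polarization.exists_orthonormal_graded_basis`, in which
`h(x, y) = Σ_σ x_σ conj(y_σ)`, `form_weil_conj_eq_sum`). We prove:

* `form_weil_weil` (`C` is a `ψ_ℂ`-isometry) and `conj_weil` (`C` is real);
* `form_weil_conj_baseChange_apply`: for `X ∈ Lie(Hdg)` (rational, `ψ`-skew) the `h`-adjoint of
  `X_ℂ` is `-C X_ℂ C⁻¹`, which lies in `𝔥_ℂ` (`Ad(C)`-stability, `ZarhinHodgeGroupLieAlgebra`);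
  hence `𝔥_ℂ = hodgeLieC H` is closed under `h`-adjoints (`exists_adjoint_mem_hodgeLieC`) — the
  tree's form of "the Hodge group of a polarizable Hodge structure is reductive" (Deligne,
  LNM 900, I Prop. 3.6; Green–Griffiths–Kerr (I.B.6)), at the level of the Lie algebra;
* `eq_bot_or_forall_mem_of_hodgeLieC_stable` (**the irreducibility input of Zarhin's theorem**):
  if `U ⊆ V_ℂ` is `𝔥_ℂ`-stable and contained in a simultaneous eigenspace
  `T_χ = {x | a_ℂ x = χ(a) x for all a ∈ End_Hdg(V)}` of the endomorphism algebra, then `U = 0`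
  or `U ⊇ T_χ`. Proof: the `h`-orthogonal complement `U^⊥` is `𝔥_ℂ`-stable, `V_ℂ = U ⊕ U^⊥`
  (transport to `EuclideanSpace ℂ`), so the projector onto `U` commutes with `𝔥_ℂ` and lies in
  `span_ℂ {a_ℂ | a ∈ End_Hdg(V)}` (commutant, `mem_span_endAlg_of_forall_commute`), hence acts
  on `T_χ` by a scalar. In Zarhin's argument (Zarhin 1983, §2; Huybrechts Thm. 3.3.9) this is
  "`T_σ` is an irreducible `Lie(Hdg)_ℂ`-module", there deduced from semisimplicity of `Hdg` and
  `End_{Hdg}(T) = E`.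

No definitions, no named facts.

## References

* P. Deligne, *Hodge cycles on abelian varieties*, LNM 900 (1982), I, Prop. 3.6.
* M. Green, P. Griffiths, M. Kerr, *Mumford–Tate groups and domains* (2012), (I.B.6).
* Yu. G. Zarhin, *Hodge groups of K3 surfaces*, J. reine angew. Math. 341 (1983), §2.
* D. Huybrechts, *Lectures on K3 Surfaces* (CUP 2016), Ch. 3, Thm. 3.3.9.
-/

noncomputable section

open scoped TensorProduct InnerProductSpace
open Complex

namespace Literature.AlgebraicGeometry.Motives

namespace HodgeStructure

universe u

variable {V : Type u} [AddCommGroup V] [Module ℚ V] [Module.Finite ℚ V] [HodgeTensorFacts.{u, u}]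
  {n : ℤ} {H : HodgeStructure V n}

/-! ### The Weil operator: isometry, reality, and the Hodge form in an orthonormal graded basis -/

section Weil

variable (ψ : H.Polarization) {C : (ℂ ⊗[ℚ] V) ≃ₗ[ℂ] (ℂ ⊗[ℚ] V)}
  (hC : ∀ p, ∀ x ∈ H.piece p (n - p), C x = (Complex.I ^ (2 * p - n)) • x)

omit [Module.Finite ℚ V] [HodgeTensorFacts.{u, u}] in
/-- `i^{2p-n} = i^p / i^{n-p}` is the tree's `hodgeSign n p`. [folklore] -/
theorem I_zpow_eq_hodgeSign (n p : ℤ) : Complex.I ^ (2 * p - n) = hodgeSign n p := by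
  rw [hodgeSign, ← zpow_neg, ← zpow_add₀ Complex.I_ne_zero]
  congr 1
  ring

omit [Module.Finite ℚ V] [HodgeTensorFacts.{u, u}] in
/-- `conj (i^k) = i^{-k}`. [folklore] -/
theorem conj_I_zpow_eq_zpow_neg (k : ℤ) : starRingEnd ℂ (Complex.I ^ k) = Complex.I ^ (-k) := by
  rw [map_zpow₀, Complex.conj_I, zpow_neg, ← inv_zpow, Complex.inv_I]

include hC in
omit [Module.Finite ℚ V] [HodgeTensorFacts.{u, u}] in
/-- **The Weil operator is real**: `conj (C x) = C (conj x)` (`C` acts by `i^{2p-n}` on `V^{p,n-p}`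
and `conj V^{p,q} = V^{q,p}`). [folklore] -/
theorem conj_weil (x : ℂ ⊗[ℚ] V) : conj (C x) = C (conj x) := by
  have htop : (⨆ p : ℤ, H.piece p (n - p)) = ⊤ := iSup_piece_eq_top_holds H
  have hx : x ∈ ⨆ p : ℤ, H.piece p (n - p) := htop ▸ Submodule.mem_top
  induction hx using Submodule.iSup_induction' with
  | mem p x hx =>
    have hcx : conj x ∈ H.piece (n - p) (n - (n - p)) := by
      rw [sub_sub_cancel]; exact conj_mem_piece H hx
    rw [hC p x hx, conj_smul, hC (n - p) _ hcx, conj_I_zpow_eq_zpow_neg]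
    congr 1
    congr 1
    ring
  | zero => simp
  | add x y _ _ hx hy => rw [map_add, map_add, map_add, map_add, hx, hy]

include hC in
omit [Module.Finite ℚ V] [HodgeTensorFacts.{u, u}] in
/-- **The Weil operator is a `ψ_ℂ`-isometry**: `ψ_ℂ(C x, C y) = ψ_ℂ(x, y)` (`C` acts by
`i^{2p-n}` on `V^{p,n-p}`, and `ψ_ℂ(V^{p,·}, V^{p',·}) = 0` unless `p + p' = n`, first
Hodge–Riemann relation). [folklore] -/
theorem form_weil_weil (x y : ℂ ⊗[ℚ] V) :
    ψ.form.baseChange ℂ (C x) (C y) = ψ.form.baseChange ℂ x y := by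
  have htop : (⨆ p : ℤ, H.piece p (n - p)) = ⊤ := iSup_piece_eq_top_holds H
  have hx : x ∈ ⨆ p : ℤ, H.piece p (n - p) := htop ▸ Submodule.mem_top
  have hy : y ∈ ⨆ p : ℤ, H.piece p (n - p) := htop ▸ Submodule.mem_top
  induction hx using Submodule.iSup_induction' generalizing y with
  | mem p x hx =>
    induction hy using Submodule.iSup_induction' with
    | mem p' y hy =>
      rw [hC p x hx, hC p' y hy]
      simp only [map_smul, LinearMap.smul_apply, smul_eq_mul]
      by_cases hpp : p + p' = n
      · rw [← mul_assoc, ← zpow_add₀ Complex.I_ne_zero, show 2 * p' - n + (2 * p - n) = 0 by omega,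
          zpow_zero, one_mul]
      · rw [ψ.form_piece_piece hpp hx hy, mul_zero, mul_zero]
    | zero => simp
    | add y y' _ _ hy hy' => rw [map_add, map_add, map_add, hy, hy']
  | zero => simp
  | add x x' _ _ hx hx' =>
    rw [map_add, map_add, LinearMap.add_apply, map_add, LinearMap.add_apply, hx y hy, hx' y hy]

include hC in
omit [Module.Finite ℚ V] [HodgeTensorFacts.{u, u}] in
/-- The inverse Weil operator is also an isometry: `ψ_ℂ(C⁻¹ x, y) = ψ_ℂ(x, C y)`. [folklore] -/
theorem form_weil_symm (x y : ℂ ⊗[ℚ] V) :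
    ψ.form.baseChange ℂ (C.symm x) y = ψ.form.baseChange ℂ x (C y) := by
  conv_rhs => rw [← C.apply_symm_apply x]
  exact (form_weil_weil ψ hC (C.symm x) y).symm

include hC in
omit [Module.Finite ℚ V] [HodgeTensorFacts.{u, u}] in
/-- `conj (C⁻¹ x) = C⁻¹ (conj x)`. [folklore] -/
theorem conj_weil_symm (x : ℂ ⊗[ℚ] V) : conj (C.symm x) = C.symm (conj x) := by
  apply C.injective
  rw [← conj_weil hC, C.apply_symm_apply, C.apply_symm_apply]

include hC in
omit [Module.Finite ℚ V] [HodgeTensorFacts.{u, u}] in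
/-- **The `h`-adjoint of a real skew endomorphism.** If `X_ℂ` is `ψ_ℂ`-skew (`X ∈ Lie(Hdg)`), then
for the Hodge form `h(u, v) = ψ_ℂ(C u, conj v)`:
`h(X_ℂ x, y) = h(x, -(C X_ℂ C⁻¹) y)` — the `h`-adjoint of `X_ℂ` is `-C X_ℂ C⁻¹`. [folklore] -/
theorem form_weil_conj_baseChange_apply {X : Module.End ℚ V}
    (hX : ∀ u v : ℂ ⊗[ℚ] V, ψ.form.baseChange ℂ (X.baseChange ℂ u) v =
      -ψ.form.baseChange ℂ u (X.baseChange ℂ v)) (x y : ℂ ⊗[ℚ] V) :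
    ψ.form.baseChange ℂ (C (X.baseChange ℂ x)) (conj y) =
      ψ.form.baseChange ℂ (C x) (conj (-(C (X.baseChange ℂ (C.symm y))))) := by
  have h1 : conj (-(C (X.baseChange ℂ (C.symm y)))) = -(C (X.baseChange ℂ (C.symm (conj y)))) := by
    rw [map_neg, conj_weil hC, conj_baseChange, conj_weil_symm hC]
  rw [h1, map_neg, form_weil_weil ψ hC]
  conv_lhs => rw [← C.apply_symm_apply (conj y)]
  rw [form_weil_weil ψ hC, hX]

omit [Module.Finite ℚ V] [HodgeTensorFacts.{u, u}] in
/-- **The Hodge form in an `h`-orthonormal graded basis**: if `e` is a graded basis with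
`ψ_ℂ(e σ, conj (e τ)) = δ_{στ} / hodgeSign n (deg σ)` (`exists_orthonormal_graded_basis`), then
`h(x, y) = ψ_ℂ(C x, conj y) = Σ_σ x_σ conj(y_σ)` in the coordinates of `e`. [folklore] -/
theorem form_weil_conj_eq_sum {S : Type u} [Fintype S] [DecidableEq S] {deg : S → ℤ}
    (e : Module.Basis S ℂ (ℂ ⊗[ℚ] V))
    (hF : ∀ a, H.F a = Submodule.span ℂ (e '' {σ | a ≤ deg σ}))
    (hFc : ∀ a, complexConj (H.F a) = Submodule.span ℂ (e '' {σ | deg σ ≤ n - a}))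
    (horth : ∀ σ τ, ψ.form.baseChange ℂ (e σ) (conj (e τ)) =
      if σ = τ then (hodgeSign n (deg σ))⁻¹ else 0)
    (hC : ∀ p, ∀ x ∈ H.piece p (n - p), C x = (Complex.I ^ (2 * p - n)) • x) (x y : ℂ ⊗[ℚ] V) :
    ψ.form.baseChange ℂ (C x) (conj y) = ∑ σ, e.repr x σ * starRingEnd ℂ (e.repr y σ) := by
  have hCe : ∀ σ, C (e σ) = hodgeSign n (deg σ) • e σ := fun σ => by
    rw [← I_zpow_eq_hodgeSign]
    exact apply_basis_eq_of_forall_piece H e hF hFc (f := fun d => Complex.I ^ (2 * d - n)) hC σ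
  have hx : C x = ∑ σ, (e.repr x σ * hodgeSign n (deg σ)) • e σ := by
    conv_lhs => rw [← e.sum_repr x]
    rw [map_sum]
    refine Finset.sum_congr rfl fun σ _ => ?_
    rw [map_smul, hCe, smul_smul]
  have hy : conj y = ∑ τ, starRingEnd ℂ (e.repr y τ) • conj (e τ) := by
    conv_lhs => rw [← e.sum_repr y]
    rw [map_sum]
    refine Finset.sum_congr rfl fun τ _ => ?_
    rw [conj_smul]
  rw [hx, hy, LinearMap.map_sum₂]
  refine Finset.sum_congr rfl fun σ _ => ?_
  rw [LinearMap.map_smul₂, map_sum, smul_eq_mul]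
  rw [Finset.sum_eq_single σ]
  · rw [map_smul, horth, if_pos rfl, smul_eq_mul]
    have := hodgeSign_ne_zero n (deg σ)
    field_simp
  · intro τ _ hτ
    rw [map_smul, horth, if_neg (Ne.symm hτ), smul_zero]
  · intro h; exact absurd (Finset.mem_univ σ) h

end Weil

/-! ### `𝔥_ℂ` is closed under Hodge-form adjoints -/

/-- **`𝔥_ℂ` is closed under `h`-adjoints** ("reductivity of `Hdg` for polarizable `H`", Deligne
I 3.6 / GGK (I.B.6), at the Lie algebra level): for every `Y ∈ 𝔥_ℂ` there is `Y' ∈ 𝔥_ℂ` with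
`h(Y' x, y) = h(x, Y y)` for all `x, y`, where `h(u, v) = ψ_ℂ(C u, conj v)`. On generators
`Y = X_ℂ`, `Y' = -C X_ℂ C⁻¹` (`form_weil_conj_baseChange_apply` and hermitian symmetry of `h`).
[cite: Deligne1982HodgeCycles, I Prop. 3.6] -/
theorem exists_adjoint_mem_hodgeLieC (ψ : H.Polarization) {C : (ℂ ⊗[ℚ] V) ≃ₗ[ℂ] (ℂ ⊗[ℚ] V)}
    (hC : ∀ p, ∀ x ∈ H.piece p (n - p), C x = (Complex.I ^ (2 * p - n)) • x)
    {Y : Module.End ℂ (ℂ ⊗[ℚ] V)} (hY : Y ∈ H.hodgeLieC) :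
    ∃ Y' ∈ H.hodgeLieC, ∀ x y : ℂ ⊗[ℚ] V,
      ψ.form.baseChange ℂ (C (Y' x)) (conj y) = ψ.form.baseChange ℂ (C x) (conj (Y y)) := by
  classical
  -- hermitian symmetry of `h`, from the orthonormal basis formula
  obtain ⟨S, _, _, deg, e, hF, hFc, -, horth⟩ := ψ.exists_orthonormal_graded_basis
  have hsum := form_weil_conj_eq_sum ψ e hF hFc horth hC
  have hherm : ∀ x y : ℂ ⊗[ℚ] V, ψ.form.baseChange ℂ (C y) (conj x) =
      starRingEnd ℂ (ψ.form.baseChange ℂ (C x) (conj y)) := by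
    intro x y
    rw [hsum, hsum, map_sum]
    refine Finset.sum_congr rfl fun σ _ => ?_
    rw [map_mul, starRingEnd_self_apply, mul_comm]
  induction hY using Submodule.span_induction with
  | mem Z hZ =>
    obtain ⟨X, hX, rfl⟩ := hZ
    refine ⟨-((C : ℂ ⊗[ℚ] V →ₗ[ℂ] ℂ ⊗[ℚ] V) ∘ₗ X.baseChange ℂ ∘ₗ
      (C.symm : ℂ ⊗[ℚ] V →ₗ[ℂ] ℂ ⊗[ℚ] V)), H.hodgeLieC.neg_mem
        (H.conj_mem_hodgeLieC_of_forall_piece hC (H.baseChange_mem_hodgeLieC hX)), fun x y => ?_⟩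
    have hskew := formBaseChange_skew_of_mem_hodgeLieC ψ (H.baseChange_mem_hodgeLieC hX)
    change ψ.form.baseChange ℂ (C (-(C (X.baseChange ℂ (C.symm x))))) (conj y) =
      ψ.form.baseChange ℂ (C x) (conj (X.baseChange ℂ y))
    rw [hherm y (-(C (X.baseChange ℂ (C.symm x)))), ← form_weil_conj_baseChange_apply ψ hC hskew y x,
      ← hherm]
  | zero => exact ⟨0, H.hodgeLieC.zero_mem, fun x y => by simp⟩
  | add Z Z' _ _ hZ hZ' =>
    obtain ⟨Y₁, h₁, h₁'⟩ := hZ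
    obtain ⟨Y₂, h₂, h₂'⟩ := hZ'
    refine ⟨Y₁ + Y₂, H.hodgeLieC.add_mem h₁ h₂, fun x y => ?_⟩
    rw [LinearMap.add_apply, LinearMap.add_apply, map_add, map_add, LinearMap.add_apply, map_add,
      map_add, h₁', h₂']
  | smul c Z _ hZ =>
    obtain ⟨Y₁, h₁, h₁'⟩ := hZ
    refine ⟨starRingEnd ℂ c • Y₁, H.hodgeLieC.smul_mem _ h₁, fun x y => ?_⟩
    simp only [LinearMap.smul_apply, map_smul, conj_smul, h₁']

/-! ### Stable subspaces of an `End_Hdg`-eigenspace are trivial -/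

omit [Module.Finite ℚ V] [HodgeTensorFacts.{u, u}] in
/-- Every element of `span_ℂ {a_ℂ | a ∈ End_Hdg(V)}` acts by a scalar on the vectors of a
simultaneous eigenspace `T_χ` of `End_Hdg(V)`. [folklore] -/
theorem exists_forall_apply_eq_smul_of_mem_span_endAlg (χ : H.endAlg → ℂ)
    {π : Module.End ℂ (ℂ ⊗[ℚ] V)}
    (hπ : π ∈ Submodule.span ℂ ((fun a : Module.End ℚ V => a.baseChange ℂ) '' (H.endAlg : Set _))) :
    ∃ c : ℂ, ∀ x : ℂ ⊗[ℚ] V,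
      (∀ a : H.endAlg, (a : Module.End ℚ V).baseChange ℂ x = χ a • x) → π x = c • x := by
  induction hπ using Submodule.span_induction with
  | mem Z hZ =>
    obtain ⟨a, ha, rfl⟩ := hZ
    exact ⟨χ ⟨a, ha⟩, fun x hx => hx ⟨a, ha⟩⟩
  | zero => exact ⟨0, fun x _ => by simp⟩
  | add Z Z' _ _ hZ hZ' =>
    obtain ⟨c₁, h₁⟩ := hZ
    obtain ⟨c₂, h₂⟩ := hZ'
    exact ⟨c₁ + c₂, fun x hx => by rw [LinearMap.add_apply, h₁ x hx, h₂ x hx, add_smul]⟩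
  | smul c Z _ hZ =>
    obtain ⟨c₁, h₁⟩ := hZ
    exact ⟨c * c₁, fun x hx => by rw [LinearMap.smul_apply, h₁ x hx, smul_smul]⟩

/-- **Irreducibility input of Zarhin's theorem.** Let `(H, ψ)` be a polarized Hodge structure on
a finite-dimensional `V`, `χ : End_Hdg(V) → ℂ`, and `U ⊆ V_ℂ` a `𝔥_ℂ`-stable subspace whose
vectors are `χ`-eigenvectors of every `a_ℂ`, `a ∈ End_Hdg(V)`. Then `U = 0` or `U` contains the
whole simultaneous eigenspace `T_χ = {x | ∀ a, a_ℂ x = χ(a) x}`. (Zarhin 1983, §2: "`T_σ` is an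
irreducible `Lie(Hdg T)_ℂ`-module"; here from positivity: the `h`-orthogonal complement of `U` is
`𝔥_ℂ`-stable, so the projector onto `U` lies in the commutant `End_Hdg(V) ⊗ ℂ` and is a scalar on
`T_χ`.) [cite: Zarhin1983HodgeGroupsK3, §2] -/
theorem eq_bot_or_forall_mem_of_hodgeLieC_stable (ψ : H.Polarization) (χ : H.endAlg → ℂ)
    {U : Submodule ℂ (ℂ ⊗[ℚ] V)}
    (hUχ : ∀ x ∈ U, ∀ a : H.endAlg, (a : Module.End ℚ V).baseChange ℂ x = χ a • x)
    (hU : ∀ Y ∈ H.hodgeLieC, ∀ x ∈ U, Y x ∈ U) :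
    U = ⊥ ∨ ∀ x : ℂ ⊗[ℚ] V, (∀ a : H.endAlg, (a : Module.End ℚ V).baseChange ℂ x = χ a • x) → x ∈ U := by
  classical
  obtain ⟨C, hC, -⟩ := exists_weilOperator H
  obtain ⟨S, _, _, deg, e, hF, hFc, -, horth⟩ := ψ.exists_orthonormal_graded_basis
  have hsum := form_weil_conj_eq_sum ψ e hF hFc horth hC
  -- transport to `EuclideanSpace ℂ S` along the coordinates of `e`
  let φ : (ℂ ⊗[ℚ] V) ≃ₗ[ℂ] EuclideanSpace ℂ S :=
    e.equivFun.trans (WithLp.linearEquiv 2 ℂ (S → ℂ)).symm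
  have hφ : ∀ x y : ℂ ⊗[ℚ] V,
      ⟪φ x, φ y⟫_ℂ = starRingEnd ℂ (ψ.form.baseChange ℂ (C x) (conj y)) := by
    intro x y
    rw [hsum, map_sum]
    change ⟪WithLp.toLp 2 (e.equivFun x), WithLp.toLp 2 (e.equivFun y)⟫_ℂ = _
    rw [EuclideanSpace.inner_toLp_toLp, dotProduct]
    refine Finset.sum_congr rfl fun σ _ => ?_
    rw [Module.Basis.equivFun_apply, Module.Basis.equivFun_apply, map_mul, starRingEnd_self_apply,
      mul_comm]
    rfl
  -- the `h`-orthogonal complement of `U`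
  let Uφ : Submodule ℂ (EuclideanSpace ℂ S) := U.map (φ : (ℂ ⊗[ℚ] V) →ₗ[ℂ] EuclideanSpace ℂ S)
  let Uo : Submodule ℂ (ℂ ⊗[ℚ] V) := Uφᗮ.comap (φ : (ℂ ⊗[ℚ] V) →ₗ[ℂ] EuclideanSpace ℂ S)
  have hUo : ∀ y, y ∈ Uo ↔ ∀ x ∈ U, ψ.form.baseChange ℂ (C x) (conj y) = 0 := by
    intro y
    change φ y ∈ Uφᗮ ↔ _
    rw [Submodule.mem_orthogonal]
    constructor
    · intro h x hx
      have := h (φ x) ⟨x, hx, rfl⟩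
      rw [hφ, map_eq_zero] at this
      exact this
    · rintro h _ ⟨x, hx, rfl⟩
      change ⟪φ x, φ y⟫_ℂ = 0
      rw [hφ, h x hx, map_zero]
  -- `U^⊥` is `𝔥_ℂ`-stable (adjoints stay in `𝔥_ℂ`)
  have hUo_stab : ∀ Y ∈ H.hodgeLieC, ∀ y ∈ Uo, Y y ∈ Uo := by
    intro Y hY y hy
    obtain ⟨Y', hY', hadj⟩ := exists_adjoint_mem_hodgeLieC ψ hC hY
    rw [hUo] at hy ⊢
    intro x hx
    rw [← hadj, hy _ (hU Y' hY' x hx)]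
  -- `V_ℂ = U ⊕ U^⊥`
  have hcompl : IsCompl U Uo := by
    haveI : CompleteSpace Uφ := FiniteDimensional.complete ℂ Uφ
    have hc : IsCompl Uφ Uφᗮ := Uφ.isCompl_orthogonal
    refine ⟨Submodule.disjoint_def.2 fun x hxU hxo => ?_, codisjoint_iff.2 (eq_top_iff.2 fun x _ => ?_)⟩
    · have h1 : φ x ∈ Uφ ⊓ Uφᗮ := ⟨⟨x, hxU, rfl⟩, hxo⟩
      rw [hc.inf_eq_bot, Submodule.mem_bot] at h1
      exact φ.injective (h1.trans (map_zero φ).symm)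
    · have h2 : φ x ∈ Uφ ⊔ Uφᗮ := hc.sup_eq_top ▸ Submodule.mem_top
      obtain ⟨a, ha, b, hb, hab⟩ := Submodule.mem_sup.1 h2
      obtain ⟨a', ha', rfl⟩ := ha
      refine Submodule.mem_sup.2 ⟨a', ha', φ.symm b, ?_, ?_⟩
      · change φ (φ.symm b) ∈ Uφᗮ
        rwa [φ.apply_symm_apply]
      · apply φ.injective
        rw [map_add, φ.apply_symm_apply]
        exact hab
  -- the projector onto `U` along `U^⊥` commutes with `𝔥_ℂ`
  set π := U.projection Uo hcompl with hπ
  have hπcomm : ∀ Y ∈ H.hodgeLieC, π * Y = Y * π := by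
    intro Y hY
    apply LinearMap.ext fun w => ?_
    obtain ⟨a, ha, b, hb, rfl⟩ := Submodule.mem_sup.1 (hcompl.sup_eq_top ▸ Submodule.mem_top : w ∈ U ⊔ Uo)
    change π (Y (a + b)) = Y (π (a + b))
    simp only [map_add]
    rw [Submodule.projection_apply_of_mem_left hcompl ha,
      Submodule.projection_apply_of_mem_right hcompl hb,
      Submodule.projection_apply_of_mem_left hcompl (hU Y hY a ha),
      Submodule.projection_apply_of_mem_right hcompl (hUo_stab Y hY b hb), map_zero]
  have hπspan : π ∈ Submodule.span ℂ
      ((fun a : Module.End ℚ V => a.baseChange ℂ) '' (H.endAlg : Set _)) :=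
    H.mem_span_endAlg_of_forall_commute fun X hX => hπcomm _ (H.baseChange_mem_hodgeLieC hX)
  obtain ⟨c, hc⟩ := exists_forall_apply_eq_smul_of_mem_span_endAlg χ hπspan
  -- `π` is a scalar `c` on `T_χ`; either `U = 0`, or `c = 1` and `T_χ ⊆ U`
  by_cases hU0 : U = ⊥
  · exact Or.inl hU0
  · right
    obtain ⟨u, huU, hu0⟩ := (Submodule.ne_bot_iff U).1 hU0
    have hc1 : c = 1 := by
      have h := hc u (hUχ u huU)
      rw [Submodule.projection_apply_of_mem_left hcompl huU] at h
      have h' : (c - 1) • u = 0 := by rw [sub_smul, one_smul, ← h, sub_self]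
      rcases smul_eq_zero.1 h' with h'' | h''
      · exact (sub_eq_zero.1 h'')
      · exact absurd h'' hu0
    intro x hx
    have h := hc x hx
    rw [hc1, one_smul] at h
    rw [← h]
    exact Submodule.projection_apply_mem hcompl x

end HodgeStructure

end Literature.AlgebraicGeometry.Motives

end
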